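import Mathlib.Analysis.SpecialFunctions.Trigonometric.Basic
import Mathlib.Analysis.SpecialFunctions.Trigonometric.Deriv
import Mathlib.Analysis.Calculus.Deriv.MeanValue
import Mathlib.Topology.Order.IntermediateValue

/-!
# Sturm's comparison theorem for `g″ + Φ g = 0`: a zero in every interval of length `π/c` where `Φ > c²`

For a `C²` solution `g` of **`g″ + Φ g = 0`** on `[α, β]` with `β = α + π/c` and **`Φ > c²` on `(α, β)`**, `g` has
a zero in `(α, β)` (`exists_zero_of_sturm`). Proof (Sturm): the comparison function `v(θ) = sin(c(θ − α))` solves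
`v″ + c² v = 0`, is positive on `(α, β)` and vanishes at the ends with `v′(α) = c`, `v′(β) = −c`; the Wronskian
`W = g v′ − g′ v` satisfies **`W′ = (Φ − c²) g v`**. If `g` had no zero in `(α, β)` it would have a constant sign
there (intermediate value theorem), so `W` would be strictly monotone on `[α, β]` in the direction of that sign; but
`W(α) = c g(α)` and `W(β) = −c g(β)` have the opposite order (`g(α), g(β) ≥ 0`, resp. `≤ 0`, by continuity) — a
contradiction. Nothing is claimed about (N).

Blind lane: Mathlib only; no sorry; axioms ⊆ {propext, Classical.choice, Quot.sound}.
-/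

namespace Summit.Ventures.HodgeRepro2.T5SU11SturmComparison

open Filter Topology
open Set (Icc Ioo)
open scoped Real

/-! ### The comparison function `v(θ) = sin(c(θ − α))` -/

/-- `v′ = c cos(c(θ − α))`. -/
theorem hasDerivAt_comparison (c α θ : ℝ) :
    HasDerivAt (fun θ => Real.sin (c * (θ - α))) (c * Real.cos (c * (θ - α))) θ := by
  have h := (Real.hasDerivAt_sin (c * (θ - α))).comp θ (((hasDerivAt_id θ).sub_const α).const_mul c)
  refine h.congr_deriv ?_
  simp only [mul_one]
  ring

/-- `v″ = −c² sin(c(θ − α))`. -/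
theorem hasDerivAt_comparison' (c α θ : ℝ) :
    HasDerivAt (fun θ => c * Real.cos (c * (θ - α))) (-(c ^ 2 * Real.sin (c * (θ - α)))) θ := by
  have h := ((Real.hasDerivAt_cos (c * (θ - α))).comp θ (((hasDerivAt_id θ).sub_const α).const_mul c)).const_mul c
  refine h.congr_deriv ?_
  simp only [mul_one]
  ring

/-- `v > 0` on `(α, α + π/c)` for `c > 0`. -/
theorem comparison_pos {c α θ : ℝ} (hc : 0 < c) (h1 : α < θ) (h2 : θ < α + π / c) :
    0 < Real.sin (c * (θ - α)) := by
  apply Real.sin_pos_of_pos_of_lt_pi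
  · nlinarith
  · have : c * (θ - α) < c * (π / c) := by nlinarith
    rwa [mul_div_cancel₀ _ hc.ne'] at this

/-! ### The Wronskian -/

section

variable {g g' g'' Φ : ℝ → ℝ} {c α β : ℝ} (hc : 0 < c) (hβ : β = α + π / c)
  (hg : ∀ θ ∈ Icc α β, HasDerivAt g (g' θ) θ) (hg' : ∀ θ ∈ Icc α β, HasDerivAt g' (g'' θ) θ)
  (hode : ∀ θ ∈ Icc α β, g'' θ + Φ θ * g θ = 0)

include hg hg' hode in
/-- **`W′ = (Φ − c²) g v`** for `W = g v′ − g′ v`. -/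
theorem hasDerivAt_wronskian {θ : ℝ} (hθ : θ ∈ Icc α β) :
    HasDerivAt (fun θ => g θ * (c * Real.cos (c * (θ - α))) - g' θ * Real.sin (c * (θ - α)))
      ((Φ θ - c ^ 2) * g θ * Real.sin (c * (θ - α))) θ := by
  have h := ((hg θ hθ).mul (hasDerivAt_comparison' c α θ)).sub ((hg' θ hθ).mul (hasDerivAt_comparison c α θ))
  refine h.congr_deriv ?_
  have e := hode θ hθ
  linear_combination (-Real.sin (c * (θ - α))) * e

end

/-! ### Sturm's comparison theorem -/

/-- A continuous function without zeros on `(α, β)` has a constant sign there. -/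
theorem sign_const_of_no_zero {g : ℝ → ℝ} {α β : ℝ} (hαβ : α < β) (hcont : ContinuousOn g (Icc α β))
    (hne : ∀ θ ∈ Ioo α β, g θ ≠ 0) :
    (∀ θ ∈ Ioo α β, 0 < g θ) ∨ (∀ θ ∈ Ioo α β, g θ < 0) := by
  -- a zero between two points of opposite signs, by the intermediate value theorem
  have key : ∀ x ∈ Ioo α β, ∀ y ∈ Ioo α β, g x < 0 → 0 < g y → False := by
    intro x hx y hy hxneg hypos
    rcases lt_or_gt_of_ne (show x ≠ y from fun e => by rw [e] at hxneg; linarith) with hxy | hxy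
    · have hsub : Icc x y ⊆ Icc α β := Set.Icc_subset_Icc hx.1.le hy.2.le
      obtain ⟨z, hz, hz0⟩ := intermediate_value_Ioo hxy.le (hcont.mono hsub)
        (show (0 : ℝ) ∈ Ioo (g x) (g y) from ⟨hxneg, hypos⟩)
      exact hne z ⟨lt_trans hx.1 hz.1, lt_trans hz.2 hy.2⟩ hz0
    · have hsub : Icc y x ⊆ Icc α β := Set.Icc_subset_Icc hy.1.le hx.2.le
      obtain ⟨z, hz, hz0⟩ := intermediate_value_Ioo' hxy.le (hcont.mono hsub)
        (show (0 : ℝ) ∈ Ioo (g x) (g y) from ⟨hxneg, hypos⟩)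
      exact hne z ⟨lt_trans hy.1 hz.1, lt_trans hz.2 hx.2⟩ hz0
  set θ₀ := (α + β) / 2 with hθ₀
  have hθ₀m : θ₀ ∈ Ioo α β := ⟨by rw [hθ₀]; linarith, by rw [hθ₀]; linarith⟩
  rcases lt_or_gt_of_ne (hne θ₀ hθ₀m) with hneg | hpos
  · right
    intro θ hθ
    rcases lt_or_gt_of_ne (hne θ hθ) with h | h
    · exact h
    · exact absurd (key θ₀ hθ₀m θ hθ hneg h) not_false
  · left
    intro θ hθ
    rcases lt_or_gt_of_ne (hne θ hθ) with h | h
    · exact absurd (key θ hθ θ₀ hθ₀m h hpos) not_false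
    · exact h

/-- **STURM'S COMPARISON THEOREM**: if `g″ + Φ g = 0` on `[α, α + π/c]` with `Φ > c²` inside, then `g` vanishes
somewhere in `(α, α + π/c)`. -/
theorem exists_zero_of_sturm {g g' g'' Φ : ℝ → ℝ} {c α β : ℝ} (hc : 0 < c) (hβ : β = α + π / c)
    (hg : ∀ θ ∈ Icc α β, HasDerivAt g (g' θ) θ) (hg' : ∀ θ ∈ Icc α β, HasDerivAt g' (g'' θ) θ)
    (hode : ∀ θ ∈ Icc α β, g'' θ + Φ θ * g θ = 0) (hΦ : ∀ θ ∈ Ioo α β, c ^ 2 < Φ θ) :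
    ∃ θ ∈ Ioo α β, g θ = 0 := by
  have hπ := Real.pi_pos
  have hαβ : α < β := by
    rw [hβ]
    have : 0 < π / c := by positivity
    linarith
  by_contra hno
  have hno' : ∀ θ ∈ Ioo α β, g θ ≠ 0 := fun θ hθ h => hno ⟨θ, hθ, h⟩
  -- `g` is continuous on `[α, β]` and has a constant sign on `(α, β)`
  have hcont : ContinuousOn g (Icc α β) := fun θ hθ => (hg θ hθ).continuousAt.continuousWithinAt
  set W : ℝ → ℝ := fun θ => g θ * (c * Real.cos (c * (θ - α))) - g' θ * Real.sin (c * (θ - α)) with hW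
  have hWd : ∀ θ ∈ Icc α β, HasDerivAt W ((Φ θ - c ^ 2) * g θ * Real.sin (c * (θ - α))) θ :=
    fun θ hθ => hasDerivAt_wronskian hg hg' hode hθ
  have hWcont : ContinuousOn W (Icc α β) := fun θ hθ => (hWd θ hθ).continuousAt.continuousWithinAt
  -- the boundary values `W(α) = c g(α)`, `W(β) = −c g(β)`
  have hWα : W α = c * g α := by
    simp only [hW, sub_self, mul_zero, Real.cos_zero, Real.sin_zero, sub_zero]
    ring
  have hWβ : W β = -(c * g β) := by
    have e : c * (β - α) = π := by
      rw [hβ]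
      field_simp
      ring
    simp only [hW, e, Real.cos_pi, Real.sin_pi, mul_zero, sub_zero]
    ring
  -- the sign of `g` at the ends, by continuity
  have hgα_tendsto : Tendsto g (𝓝[>] α) (𝓝 (g α)) :=
    ((hg α ⟨le_rfl, hαβ.le⟩).continuousAt.tendsto).mono_left nhdsWithin_le_nhds
  have hgβ_tendsto : Tendsto g (𝓝[<] β) (𝓝 (g β)) :=
    ((hg β ⟨hαβ.le, le_rfl⟩).continuousAt.tendsto).mono_left nhdsWithin_le_nhds
  rcases sign_const_of_no_zero hαβ hcont hno' with hpos | hneg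
  · -- `g > 0`: `W` strictly increasing, but `W(α) = c g(α) ≥ 0 ≥ −c g(β) = W(β)`
    have hmono : StrictMonoOn W (Icc α β) := by
      refine strictMonoOn_of_deriv_pos (convex_Icc α β) hWcont ?_
      intro θ hθ
      rw [interior_Icc] at hθ
      rw [(hWd θ (Set.Ioo_subset_Icc_self hθ)).deriv]
      have h1 := hΦ θ hθ
      have h2 := hpos θ hθ
      have h3 := comparison_pos hc hθ.1 (hβ ▸ hθ.2)
      have : 0 < Φ θ - c ^ 2 := by linarith
      positivity
    have hgα : 0 ≤ g α := ge_of_tendsto hgα_tendsto (by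
      filter_upwards [Ioo_mem_nhdsGT hαβ] with θ hθ
      exact (hpos θ hθ).le)
    have hgβ : 0 ≤ g β := ge_of_tendsto hgβ_tendsto (by
      filter_upwards [Ioo_mem_nhdsLT hαβ] with θ hθ
      exact (hpos θ hθ).le)
    have := hmono ⟨le_rfl, hαβ.le⟩ ⟨hαβ.le, le_rfl⟩ hαβ
    rw [hWα, hWβ] at this
    nlinarith
  · -- `g < 0`: `W` strictly decreasing, but `W(α) = c g(α) ≤ 0 ≤ −c g(β) = W(β)`
    have hanti : StrictAntiOn W (Icc α β) := by
      refine strictAntiOn_of_deriv_neg (convex_Icc α β) hWcont ?_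
      intro θ hθ
      rw [interior_Icc] at hθ
      rw [(hWd θ (Set.Ioo_subset_Icc_self hθ)).deriv]
      have h1 := hΦ θ hθ
      have h2 := hneg θ hθ
      have h3 := comparison_pos hc hθ.1 (hβ ▸ hθ.2)
      have : 0 < Φ θ - c ^ 2 := by linarith
      have : 0 < (Φ θ - c ^ 2) * (-g θ) * Real.sin (c * (θ - α)) := mul_pos (mul_pos this (neg_pos.mpr h2)) h3
      linarith
    have hgα : g α ≤ 0 := le_of_tendsto hgα_tendsto (by
      filter_upwards [Ioo_mem_nhdsGT hαβ] with θ hθ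
      exact (hneg θ hθ).le)
    have hgβ : g β ≤ 0 := le_of_tendsto hgβ_tendsto (by
      filter_upwards [Ioo_mem_nhdsLT hαβ] with θ hθ
      exact (hneg θ hθ).le)
    have := hanti ⟨le_rfl, hαβ.le⟩ ⟨hαβ.le, le_rfl⟩ hαβ
    rw [hWα, hWβ] at this
    nlinarith

end Summit.Ventures.HodgeRepro2.T5SU11SturmComparison
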